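import Summits.HodgeConjecture.CorCM.AndreRiemannRationalAction
import Summits.HodgeConjecture.CorCM.AndreRiemannBiproducts
import Literature.AlgebraicGeometry.ComplexMultiplication.CMTypedOfPrincipalCMPair
import HarnessLib

/-!
# COR-CM (cell `pub-hodgecm2`), André ↦ Riemann, part 3: INFLATION of a CM-typed abelian variety to
# a larger CM field

HONEST FRAMING: one construction, no named fact. Given a realisation `(B, ι₀, θ₀)` of a CM type
`(K₀; Φ₀)` on `H¹` (`ComplexMultiplication.IsCMTypeRealisation`) and ANY number field `L ⊇ K₀`
(`kL : K₀ →+* L`, `m = [L : K₀]`), there is an abelian variety `B′`, isogenous to the power `Bᵐ`,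
carrying an action `ι′ : 𝓞_L → End B′` which realises SOME CM type `Ψ` of `L` on `H¹`, and `B` is a
direct factor of `B′` up to isogeny (`Domination.AVDominatedBy B B′`). This is the construction
`B ⊗_{K₀} L` of Shimura 1998 §6.2 (proof of Theorem 3: «ℂⁿ/D(𝔪) is isomorphic to the direct product
of `h` copies of `ℂ^m/Δ`») / Deligne 1982 §5 («Let `B_α = A_α ⊗_{E_α} E`»), assembled from:
`L ↪ Mat_m(K₀) ↪ End⁰(Bᵐ)` (regular representation on a `K₀`-basis of `L`, Mathlib
`Algebra.leftMulMatrix`; `AndreRiemann.blockAct`, `AndreRiemann.ratAction`), Shimura §7.1 Prop. 7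
(`exists_principal_pair`: a principal pair `(B′, ι′ : 𝓞_L → End B′)` isogenous to `Bᵐ`), and
§5.2 read on `H¹` (`isCMTypeRealisation_of_principal`: a principal pair of full degree
`[L:ℚ] = 2 dim B′` realises a CM type). The type `Ψ` is left existential (it is the induced type
`Φ₀^L`, not needed downstream).

## References
* [Shimura1998] G. Shimura, *Abelian Varieties with Complex Multiplication and Modular Functions*,
  Princeton 1998, §6.2 Theorem 3 (proof, pp. 41–43), §7.1 Proposition 7 (p. 47), §5.2 (pp. 36–37).
* [Deligne1982HodgeCycles] P. Deligne, *Hodge cycles on abelian varieties*, LNM 900, §5 (p. 37 of the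
  TeXed re-edition: `B_α = A_α ⊗_{E_α} E`).
-/

noncomputable section

open CategoryTheory CategoryTheory.Limits NumberField

namespace Summit.HodgeConjecture.CorCM.AndreRiemann

open Literature.AlgebraicGeometry.Motives Literature.AlgebraicGeometry.Motives.AbelianVariety
open Literature.AlgebraicGeometry.HodgeTheory Literature.AlgebraicGeometry.ComplexMultiplication
open Summit.HodgeConjecture.CorCM.Domination

/-- The degree of the CM field of a realisation is twice the dimension: `[K₀ : ℚ] = 2 dim B`
(`dim_ℂ H¹(B(ℂ); ℂ) = [K₀:ℚ]` is a clause of `IsCMTypeRealisation`, and `b₁ = 2 dim`).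
[cite: Shimura1998, §5.2 (pp. 36–37)] -/
theorem finrank_eq_two_mul_dim_of_isCMTypeRealisation {K₀ : Type} [Field K₀] [NumberField K₀]
    {Φ₀ : CMType K₀} {B : AbelianVariety ℂ} {ι₀ : 𝓞 K₀ →+* End B}
    {θ₀ : K₀ →+* Module.End ℂ (complexBetti B.X 1)} (h : IsCMTypeRealisation Φ₀ B ι₀ θ₀) :
    Module.finrank ℚ K₀ = 2 * B.dim := by
  have h1 := h.2.1
  rw [← BettiUniverse.finrank_bettiCohomology_eq (AbelianVariety.isSmoothProjective_holds (A := B)) 1,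
    finrank_bettiCohomology_one] at h1
  exact h1.symm

/-- **Inflation** (Shimura §6.2, `B ⊗_{K₀} L`): a realisation of a CM type of `K₀` and a number
field `L ⊇ K₀` give a realisation `(B′, ι′, θ′)` of some CM type `Ψ` of `L` with `B` a direct
factor of `B′` up to isogeny (`B′ ∼ B^{[L:K₀]}` with `L` acting through `L ↪ Mat(K₀)`, made principal
by Shimura §7.1 Prop. 7; the type is read on `H¹` by §5.2).
[cite: Shimura1998, §6.2 Theorem 3 (proof, pp. 41–43), §7.1 Proposition 7 (p. 47), §5.2 (pp. 36–37)]
[cite: Deligne1982HodgeCycles, §5] -/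
theorem exists_inflation {K₀ : Type} [Field K₀] [NumberField K₀] {Φ₀ : CMType K₀}
    {B : AbelianVariety ℂ} {ι₀ : 𝓞 K₀ →+* End B} {θ₀ : K₀ →+* Module.End ℂ (complexBetti B.X 1)}
    (h : IsCMTypeRealisation Φ₀ B ι₀ θ₀) {L : Type} [Field L] [NumberField L] (kL : K₀ →+* L) :
    ∃ (B' : AbelianVariety ℂ) (Ψ : CMType L) (ι' : 𝓞 L →+* End B')
      (θ' : L →+* Module.End ℂ (complexBetti B'.X 1)),
      IsCMTypeRealisation Ψ B' ι' θ' ∧ AVDominatedBy B B' := by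
  classical
  letI : Algebra K₀ L := kL.toAlgebra
  haveI : IsScalarTower ℚ K₀ L := IsScalarTower.of_algebraMap_eq fun q => by
    rw [RingHom.algebraMap_toAlgebra, eq_ratCast, eq_ratCast, map_ratCast]
  haveI : Module.Finite K₀ L := Module.Finite.of_restrictScalars_finite ℚ K₀ L
  -- `[K₀:ℚ] = 2 dim B`, `m = [L:K₀] ≥ 1`, `[L:ℚ] = m [K₀:ℚ]`
  have hK₀ := finrank_eq_two_mul_dim_of_isCMTypeRealisation h
  set m := Module.finrank K₀ L with hm
  have hm0 : 0 < m := Module.finrank_pos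
  have hLdeg : Module.finrank ℚ L = m * Module.finrank ℚ K₀ := by
    rw [← Module.finrank_mul_finrank ℚ K₀ L, mul_comm]
  -- `L ↪ Mat_m(K₀) ↪ End⁰(Bᵐ)`
  let γ := Module.finBasis K₀ L
  let φL : L →+* (⨁ fun _ : Fin m => B).endAlgebra :=
    (blockAct (ratAction ι₀)).comp (Algebra.leftMulMatrix γ).toRingHom
  -- the principal pair in the isogeny class of `Bᵐ` (Shimura §7.1 Prop. 7)
  obtain ⟨B', φ', ι', hφι, u, hu⟩ := exists_principal_pair φL
  have hL : Module.finrank ℚ L = 2 * B'.dim := by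
    rw [← dim_eq_of_isIsogeny hu, dim_biproduct_const, hLdeg, hK₀]
    ring
  -- the CM type read on `H¹` (Shimura §5.2)
  obtain ⟨Ψ, hΨ⟩ := isCMTypeRealisation_of_principal φ' hL ι' hφι
  exact ⟨B', Ψ, ι', complexAction φ', hΨ, avDominatedBy_of_isIsogenous_pow hm0 ⟨u, hu⟩⟩

end Summit.HodgeConjecture.CorCM.AndreRiemann

end
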